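import Summits.AnomalousDissipation.AnomalousDissipation.Theorems.SolenoidalFractalHomogenisationLagrangianCarrierConstructionRegularLConjugation
import Summits.AnomalousDissipation.AnomalousDissipation.Theorems.SolenoidalFractalHomogenisationLagrangianCarrierConstructionRegularLNearIdentity
import Summits.AnomalousDissipation.AnomalousDissipation.Theorems.SolenoidalFractalHomogenisationLagrangianCarrierConstructionRegularLLevelC2
import Literature.Analysis.FunctionSpaces.TorusHolderBridge
import HarnessLib

/-!
# K3L `LagrangianCarrierConstruction` (stmt-AnomalousDissipation-24913), line `birth`, stub `stub_regularL`: LEVEL BOUNDS from the distortion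
# tower — sup and Lipschitz bounds of the Lagrangian levels `b (m+1) t` (helper; `--supports stmt-AnomalousDissipation-24913`)

Summits-side helper file (everything proved; no definitions, no named facts). For the abstract carrier `E` of `stub_regularL`: if on the refresh
windows of level `m+1` the coarse flows satisfy `‖DΦ_m(s→t) − I‖ ≤ δ` (distortion) and `‖DΦ_m(w→t)(z) − DΦ_m(w→t)(z')‖ ≤ Γ ‖z − z'‖` (curvature,
`w` the window's left end), then, `b (m+1) t` being the Eulerian level `v_{m+1}(t)` (sup `k a/(2πN)`, gradient `3√3 k a`) pushed forward by
`Φ_m(w→t)` (`IsInserted`, `…RegularLConjugation.b_succ_proj_evolutionMap`):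
* `‖b (m+1) t x‖ ≤ (1+δ) · k a_{m+1}/(2π N_{m+1})` (`norm_b_succ_le_of_distortion`);
* the lift of `b (m+1) t` is Lipschitz with constant `(1+δ)(Γ · k a_{m+1}/(2πN_{m+1}) + (1+δ) · 3√3 k a_{m+1})`
  (`norm_lift_b_succ_sub_le_of_distortion`: `lift b = F ∘ Φ_m(t→w)`, `F(y) = DΦ_m(w→t)(y) v(t,y)`), hence `b (m+1) t` is Lipschitz on the
  torus with `√3` times that constant (`lipschitzWith_b_succ_of_distortion`, good lifts).
With the tower's `δ = 1/10`, `Γ = 3 L θ₀ N_m² ≤ 3 L θ₀ N_{m+1}` these are `≲ a_{m+1}/N_{m+1}` and `≲ a_{m+1}` — the two inputs of the Hölder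
interpolation in `stub_regularL` (Armstrong–Vicol, arXiv:2305.05048, §2.2 p. 18: `|b_m − b_{m−1}| ≲ a_m ε_m`, `|∇(b_m − b_{m−1})| ≲ a_m`).
Infrastructure for route-1's rung leaf F-D1.A0 (a frontier FORMAL rung); NOT a proof of anomalous dissipation.
-/

set_option linter.dupNamespace false

noncomputable section

namespace Summit.AnomalousDissipation.AnomalousDissipation.Theorems.SolenoidalFractalHomogenisation.LagrangianCarrierConstruction

open Set Function Filter Topology MeasureTheory
open scoped NNReal ContDiff
open Literature.Analysis Literature.Analysis.ODE Literature.Analysis.FunctionSpaces Literature.Analysis.FunctionSpaces.Torus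
open Literature.Analysis.FluidPDE Literature.Analysis.FluidPDE.LatticeShear
open Summit.AnomalousDissipation.AnomalousDissipation.Theorems.SolenoidalFractalHomogenisation.PermissibleCarrier (norm_level_le)
open Summit.AnomalousDissipation.AnomalousDissipation.Theorems.SolenoidalFractalHomogenisation.LagrangianCarrier
  (lipschitzWith_lift_level)

variable {k : ℕ}

/-- **Sup bound of a Lagrangian level from the window distortion.** If `‖DΦ_m(w→t) − I‖ ≤ δ` on every window of level `m+1` (`w` its left
end), then `‖b (m+1) t x‖ ≤ (1+δ) · k a_{m+1}/(2π N_{m+1})`. [cite: ArmstrongVicol2025, §2.2 (PDF p. 18: |b_m − b_{m−1}| ≲ a_m ε_m)] -/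
theorem norm_b_succ_le_of_distortion (E : LagrangianLatticeCarrier k) (m : ℕ) (hL : E.IsLagrangian)
    (h1 : ∀ m, Continuous (uncurry (E.b (m + 1)))) (h3a : ∀ m t, IsSmooth (E.b (m + 1) t))
    (h3b : ∀ m (n : ℕ), ∃ C : ℝ, ∀ t y, ‖iteratedFDeriv ℝ n (Torus.lift (E.b (m + 1) t)) y‖ ≤ C)
    (hF1a : ∀ m s, Continuous fun p : ℝ × UnitAddTorus (Fin 3) => E.disp m p.1 s p.2)
    (hF1b : ∀ m t s, IsSmooth (E.disp m t s)) {δ : ℝ}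
    (hδ : ∀ (j : ℤ), ∀ t ∈ E.window (m + 1) j, ∀ z,
      ‖fderiv ℝ (evolutionMap (fun t (z : EuclideanSpace ℝ (Fin 3)) => E.partialSum m t (proj z)) ((j : ℝ) * E.refresh (m + 1)) t) z -
        ContinuousLinearMap.id ℝ (EuclideanSpace ℝ (Fin 3))‖ ≤ δ)
    (t : ℝ) (x : UnitAddTorus (Fin 3)) :
    ‖E.b (m + 1) t x‖ ≤ (1 + δ) * (k * E.a (m + 1) / (2 * Real.pi * E.N (m + 1))) := by
  set j : ℤ := ⌊t / E.refresh (m + 1)⌋ with hj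
  have ht : t ∈ E.window (m + 1) j := mem_window_floor E (m + 1) t
  obtain ⟨y, hy⟩ := surjective_X_of_regular E m (hL m).1 h1 h3a h3b hF1a t ((j : ℝ) * E.refresh (m + 1)) x
  have hins := (hL m).2 j t ht y
  rw [hy] at hins
  rw [hins]
  have hD : E.flowDeriv m t ((j : ℝ) * E.refresh (m + 1)) y =
      fderiv ℝ (evolutionMap (fun t (z : EuclideanSpace ℝ (Fin 3)) => E.partialSum m t (proj z)) ((j : ℝ) * E.refresh (m + 1)) t) (repr y) := by
    rw [fderiv_evolutionMap_partialSum E m (hL m).1 h1 h3a h3b hF1a hF1b, proj_repr]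
  have hnorm : ‖E.flowDeriv m t ((j : ℝ) * E.refresh (m + 1)) y‖ ≤ 1 + δ := by
    rw [hD]; exact norm_fderiv_le_one_add (hδ j t ht) _
  have hpos : 0 ≤ (k : ℝ) * E.a (m + 1) / (2 * Real.pi * E.N (m + 1)) := by
    have := E.toFractalCarrierData.a_pos (m + 1); have := E.toFractalCarrierData.N_pos (m + 1); positivity
  calc ‖E.flowDeriv m t ((j : ℝ) * E.refresh (m + 1)) y (E.toFractalCarrierData.level (m + 1) t y)‖
      ≤ ‖E.flowDeriv m t ((j : ℝ) * E.refresh (m + 1)) y‖ * ‖E.toFractalCarrierData.level (m + 1) t y‖ :=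
        ContinuousLinearMap.le_opNorm _ _
    _ ≤ (1 + δ) * (k * E.a (m + 1) / (2 * Real.pi * E.N (m + 1))) :=
        mul_le_mul hnorm (norm_level_le _ _ t y) (norm_nonneg _) (by linarith [(norm_nonneg _).trans hnorm])

/-- **Lipschitz bound of the lifted Lagrangian level from window distortion and curvature.**
`‖b (m+1) t (proj z) − b (m+1) t (proj z')‖ ≤ (1+δ)(Γ · k a/(2πN) + (1+δ) 3√3 k a) ‖z − z'‖`.
[cite: ArmstrongVicol2025, §2.2 (PDF p. 18: |∇(b_m − b_{m−1})| ≲ a_m) and §5.1] -/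
theorem norm_lift_b_succ_sub_le_of_distortion (E : LagrangianLatticeCarrier k) (m : ℕ) (hL : E.IsLagrangian)
    (h1 : ∀ m, Continuous (uncurry (E.b (m + 1)))) (h3a : ∀ m t, IsSmooth (E.b (m + 1) t))
    (h3b : ∀ m (n : ℕ), ∃ C : ℝ, ∀ t y, ‖iteratedFDeriv ℝ n (Torus.lift (E.b (m + 1) t)) y‖ ≤ C)
    (hF1a : ∀ m s, Continuous fun p : ℝ × UnitAddTorus (Fin 3) => E.disp m p.1 s p.2)
    (hF1b : ∀ m t s, IsSmooth (E.disp m t s)) {δ Γ : ℝ} (hΓ0 : 0 ≤ Γ)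
    (hδ : ∀ (j : ℤ) (s t : ℝ), s ∈ E.window (m + 1) j → t ∈ E.window (m + 1) j → ∀ z,
      ‖fderiv ℝ (evolutionMap (fun t (z : EuclideanSpace ℝ (Fin 3)) => E.partialSum m t (proj z)) s t) z -
        ContinuousLinearMap.id ℝ (EuclideanSpace ℝ (Fin 3))‖ ≤ δ)
    (hΓ : ∀ (j : ℤ), ∀ t ∈ E.window (m + 1) j, ∀ z z',
      ‖fderiv ℝ (evolutionMap (fun t (z : EuclideanSpace ℝ (Fin 3)) => E.partialSum m t (proj z)) ((j : ℝ) * E.refresh (m + 1)) t) z -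
        fderiv ℝ (evolutionMap (fun t (z : EuclideanSpace ℝ (Fin 3)) => E.partialSum m t (proj z)) ((j : ℝ) * E.refresh (m + 1)) t) z'‖ ≤
        Γ * ‖z - z'‖)
    (t : ℝ) (z z' : EuclideanSpace ℝ (Fin 3)) :
    ‖E.b (m + 1) t (proj z) - E.b (m + 1) t (proj z')‖ ≤
      (1 + δ) * (Γ * (k * E.a (m + 1) / (2 * Real.pi * E.N (m + 1))) + (1 + δ) * (Real.sqrt 3 * (3 * (k * E.a (m + 1))))) * ‖z - z'‖ := by
  set j : ℤ := ⌊t / E.refresh (m + 1)⌋ with hj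
  have ht : t ∈ E.window (m + 1) j := mem_window_floor E (m + 1) t
  set w : ℝ := (j : ℝ) * E.refresh (m + 1) with hw
  have hw' : w ∈ E.window (m + 1) j := left_mem_window E (m + 1) j
  have hBU := isUniformlyLipschitzOn_partialSum_proj E h1 h3a h3b m
  set Φwt := evolutionMap (fun t (z : EuclideanSpace ℝ (Fin 3)) => E.partialSum m t (proj z)) w t with hΦwt
  set G := evolutionMap (fun t (z : EuclideanSpace ℝ (Fin 3)) => E.partialSum m t (proj z)) t w with hG
  set v : EuclideanSpace ℝ (Fin 3) → EuclideanSpace ℝ (Fin 3) := fun y => E.toFractalCarrierData.level (m + 1) t (proj y) with hv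
  -- `lift b = F ∘ G` with `F y = DΦ(w→t)(y) v(y)`
  have hrepr : ∀ z, E.b (m + 1) t (proj z) = fderiv ℝ Φwt (G z) (v (G z)) := by
    intro z
    have hz : Φwt (G z) = z := evolutionMap_symm_univ hBU t w z
    have h := b_succ_proj_evolutionMap E m hL h1 h3a h3b hF1a hF1b j ht (G z)
    rw [← hΦwt, hz] at h
    exact h
  have hδ1 : 0 ≤ 1 + δ := by linarith [(norm_nonneg _).trans (hδ j w t hw' ht z)]
  -- the ingredients
  have hA : ∀ y, ‖fderiv ℝ Φwt y‖ ≤ 1 + δ := fun y => norm_fderiv_le_one_add (hδ j w t hw' ht) y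
  have hAA : ∀ y y', ‖fderiv ℝ Φwt y - fderiv ℝ Φwt y'‖ ≤ Γ * ‖y - y'‖ := hΓ j t ht
  have hvsup : ∀ y, ‖v y‖ ≤ k * E.a (m + 1) / (2 * Real.pi * E.N (m + 1)) := fun y => norm_level_le _ _ t (proj y)
  have hvlip : ∀ y y', ‖v y - v y'‖ ≤ Real.sqrt 3 * (3 * (k * E.a (m + 1))) * ‖y - y'‖ := by
    intro y y'
    have h := (lipschitzWith_lift_level E.toFractalCarrierData (m + 1) t).dist_le_mul y y'
    rw [dist_eq_norm, dist_eq_norm] at h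
    refine h.trans (le_of_eq ?_)
    congr 1
    push_cast
    rfl
  have hGlip : ‖G z - G z'‖ ≤ (1 + δ) * ‖z - z'‖ :=
    norm_sub_le_of_norm_fderiv_sub_id_le (differentiable_evolutionMap_partialSum E m (hL m).1 h1 h3a h3b hF1a hF1b t w)
      (hδ j t w ht hw') z z'
  have hpos : 0 ≤ (k : ℝ) * E.a (m + 1) / (2 * Real.pi * E.N (m + 1)) := by
    have := E.toFractalCarrierData.a_pos (m + 1); have := E.toFractalCarrierData.N_pos (m + 1); positivity
  -- `F` is Lipschitz
  have hF : ∀ y y', ‖fderiv ℝ Φwt y (v y) - fderiv ℝ Φwt y' (v y')‖ ≤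
      (Γ * (k * E.a (m + 1) / (2 * Real.pi * E.N (m + 1))) + (1 + δ) * (Real.sqrt 3 * (3 * (k * E.a (m + 1))))) * ‖y - y'‖ := by
    intro y y'
    have e : fderiv ℝ Φwt y (v y) - fderiv ℝ Φwt y' (v y') =
        (fderiv ℝ Φwt y - fderiv ℝ Φwt y') (v y) + fderiv ℝ Φwt y' (v y - v y') := by
      rw [sub_apply, map_sub]; abel
    rw [e]
    calc ‖(fderiv ℝ Φwt y - fderiv ℝ Φwt y') (v y) + fderiv ℝ Φwt y' (v y - v y')‖
        ≤ ‖fderiv ℝ Φwt y - fderiv ℝ Φwt y'‖ * ‖v y‖ + ‖fderiv ℝ Φwt y'‖ * ‖v y - v y'‖ :=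
          (norm_add_le _ _).trans (add_le_add (ContinuousLinearMap.le_opNorm _ _) (ContinuousLinearMap.le_opNorm _ _))
      _ ≤ Γ * ‖y - y'‖ * (k * E.a (m + 1) / (2 * Real.pi * E.N (m + 1))) +
            (1 + δ) * (Real.sqrt 3 * (3 * (k * E.a (m + 1))) * ‖y - y'‖) :=
          add_le_add (mul_le_mul (hAA y y') (hvsup y) (norm_nonneg _) (mul_nonneg hΓ0 (norm_nonneg _)))
            (mul_le_mul (hA y') (hvlip y y') (norm_nonneg _) hδ1)
      _ = (Γ * (k * E.a (m + 1) / (2 * Real.pi * E.N (m + 1))) + (1 + δ) * (Real.sqrt 3 * (3 * (k * E.a (m + 1))))) * ‖y - y'‖ := by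
          ring
  have hC0 : 0 ≤ Γ * (k * E.a (m + 1) / (2 * Real.pi * E.N (m + 1))) + (1 + δ) * (Real.sqrt 3 * (3 * (k * E.a (m + 1)))) := by
    have := E.toFractalCarrierData.a_pos (m + 1); positivity
  rw [hrepr z, hrepr z']
  calc ‖fderiv ℝ Φwt (G z) (v (G z)) - fderiv ℝ Φwt (G z') (v (G z'))‖
      ≤ (Γ * (k * E.a (m + 1) / (2 * Real.pi * E.N (m + 1))) + (1 + δ) * (Real.sqrt 3 * (3 * (k * E.a (m + 1))))) * ‖G z - G z'‖ :=
        hF _ _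
    _ ≤ (Γ * (k * E.a (m + 1) / (2 * Real.pi * E.N (m + 1))) + (1 + δ) * (Real.sqrt 3 * (3 * (k * E.a (m + 1))))) * ((1 + δ) * ‖z - z'‖) :=
        mul_le_mul_of_nonneg_left hGlip hC0
    _ = (1 + δ) * (Γ * (k * E.a (m + 1) / (2 * Real.pi * E.N (m + 1))) + (1 + δ) * (Real.sqrt 3 * (3 * (k * E.a (m + 1))))) * ‖z - z'‖ := by
        ring

/-- Lipschitz maps of the lift descend to the torus with a factor `√3` (good lifts). [folklore] -/
theorem lipschitzWith_of_norm_lift_sub_le {g : UnitAddTorus (Fin 3) → EuclideanSpace ℝ (Fin 3)} {C : ℝ} (hC : 0 ≤ C)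
    (h : ∀ z z' : EuclideanSpace ℝ (Fin 3), ‖g (proj z) - g (proj z')‖ ≤ C * ‖z - z'‖) :
    LipschitzWith (Real.toNNReal C * holderLiftConst (Fin 3) 1) g := by
  have hlift : LipschitzWith (Real.toNNReal C) (Torus.lift g) := by
    refine LipschitzWith.of_dist_le_mul fun z z' => ?_
    rw [dist_eq_norm, dist_eq_norm, Torus.lift_apply, Torus.lift_apply, Real.coe_toNNReal _ hC]
    exact h z z'
  exact holderWith_one.1 ((holderWith_one.2 hlift).of_lift)

/-- **Lipschitz bound of a Lagrangian level on the torus** from window distortion `δ` and curvature `Γ`: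
constant `√3 (1+δ)(Γ k a/(2πN) + (1+δ) 3√3 k a)`. [cite: ArmstrongVicol2025, §2.2 (PDF p. 18: |∇(b_m − b_{m−1})| ≲ a_m)] -/
theorem lipschitzWith_b_succ_of_distortion (E : LagrangianLatticeCarrier k) (m : ℕ) (hL : E.IsLagrangian)
    (h1 : ∀ m, Continuous (uncurry (E.b (m + 1)))) (h3a : ∀ m t, IsSmooth (E.b (m + 1) t))
    (h3b : ∀ m (n : ℕ), ∃ C : ℝ, ∀ t y, ‖iteratedFDeriv ℝ n (Torus.lift (E.b (m + 1) t)) y‖ ≤ C)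
    (hF1a : ∀ m s, Continuous fun p : ℝ × UnitAddTorus (Fin 3) => E.disp m p.1 s p.2)
    (hF1b : ∀ m t s, IsSmooth (E.disp m t s)) {δ Γ : ℝ} (hΓ0 : 0 ≤ Γ)
    (hδ : ∀ (j : ℤ) (s t : ℝ), s ∈ E.window (m + 1) j → t ∈ E.window (m + 1) j → ∀ z,
      ‖fderiv ℝ (evolutionMap (fun t (z : EuclideanSpace ℝ (Fin 3)) => E.partialSum m t (proj z)) s t) z -
        ContinuousLinearMap.id ℝ (EuclideanSpace ℝ (Fin 3))‖ ≤ δ)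
    (hΓ : ∀ (j : ℤ), ∀ t ∈ E.window (m + 1) j, ∀ z z',
      ‖fderiv ℝ (evolutionMap (fun t (z : EuclideanSpace ℝ (Fin 3)) => E.partialSum m t (proj z)) ((j : ℝ) * E.refresh (m + 1)) t) z -
        fderiv ℝ (evolutionMap (fun t (z : EuclideanSpace ℝ (Fin 3)) => E.partialSum m t (proj z)) ((j : ℝ) * E.refresh (m + 1)) t) z'‖ ≤
        Γ * ‖z - z'‖)
    (t : ℝ) :
    LipschitzWith (Real.toNNReal ((1 + δ) * (Γ * (k * E.a (m + 1) / (2 * Real.pi * E.N (m + 1))) +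
        (1 + δ) * (Real.sqrt 3 * (3 * (k * E.a (m + 1)))))) * holderLiftConst (Fin 3) 1) (E.b (m + 1) t) := by
  have hδ1 : 0 ≤ 1 + δ := by
    have h := hδ 0 _ _ (left_mem_window E (m + 1) 0) (left_mem_window E (m + 1) 0) 0
    linarith [(norm_nonneg _).trans h]
  have hC : 0 ≤ (1 + δ) * (Γ * (k * E.a (m + 1) / (2 * Real.pi * E.N (m + 1))) + (1 + δ) * (Real.sqrt 3 * (3 * (k * E.a (m + 1))))) := by
    have := E.toFractalCarrierData.a_pos (m + 1); positivity
  exact lipschitzWith_of_norm_lift_sub_le hC fun z z' =>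
    norm_lift_b_succ_sub_le_of_distortion E m hL h1 h3a h3b hF1a hF1b hΓ0 hδ hΓ t z z'

end Summit.AnomalousDissipation.AnomalousDissipation.Theorems.SolenoidalFractalHomogenisation.LagrangianCarrierConstruction

end
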